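import Summits.PneNP.PneNP.Theses.PhaseTwins
import Literature.Computability.Complexity.HardcoreInapproximability
import Literature.ModelTheory.FiniteModelTheory.CkEquivTransfer
import Literature.ModelTheory.FiniteModelTheory.CkEquivHomCount
import Literature.ModelTheory.FiniteModelTheory.CountingWidthXorHam

/-!
# Line `girth-twins` for crux `PhaseTwins.MacroscopicTwinsAbove` (stmt-PneNP-2720)

Skeleton (crux-plan, planner-cruxplan-stmt-PneNP-2720-girth-twins-0, 2026-08-16) of the crux idea
`girth-twins` (crux-ideate r1, ideator 1; triage r1-1 / r1-2 / r1-3: pass, pass, pass — "a SOURCE stub for THIS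
crux's quantifier `∀ k ∃ n`; composes with the merged parity-complex line
`literal-gadgets-cfi-apparatus ≈ hypergraph-tseitin-fixed-gadget` through its Lemma A").

THE LINE. `MacroscopicTwinsAbove` asks, for `Δ ≥ 3`, `λ > λ_c(Δ)` and a `δ = δ(Δ, λ) > 0` chosen FIRST, for
every `k` ONE pair of max-degree-`Δ` graphs on some `n` vertices, `≡_{C^k}` (hom-indistinguishable below
treewidth `k`) with `Z_G(λ) ≥ e^{δ n} Z_H(λ)`. The refuter's tightness lemmas (`Negative.defect_bound`,
`delta_le_of_blocks`; bare CFI / one Tseitin charge give `δ_k → 0`) force a POSITIVE FRACTION of frustrated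
constraints, so the twins are built from a 3XOR system `E` (scopes `E e : Fin 3 → Fin n`, `m` equations) and two
right-hand sides: `b = 0` (satisfiable) and a `b` that EVERY assignment violates on `≥ m/20` equations. What the
phase-gadget APPARATUS (the companion line; here the single contract `stub_apparatus`, conditional on Sly's
gadget theorem `stub_slyGadgets`) needs from the system is exactly three things, uniformly in `k`:
bounded OCCURRENCE (`≤ D` equations per variable — the port budget of a FIXED-size gadget), radius-`6k`
LOCAL CONSISTENCY of `(E, b)` for every `b` (Duplicator, via the tree's PROVED transfer
`ckEquiv_of_consistencyFamily` + `isConsistencyFamily_good`), and FAR-ness of `b` (energy). At FIXED `k` all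
three are elementary — this is the idea:
* `stub_girthDoubling` — GIRTH DOUBLING BY THE `ℤ₂`-VOLTAGE LIFT: a system `E : Fin (2n) → Fin 3 → Fin n` with
  injective scopes and occurrences `≤ D` whose variable–equation incidence graph has girth `≥ g` lifts to one of
  the same shape (`m' = 2n'`, injective scopes, occurrences `≤ D`) with incidence girth `≥ 2g` — variables
  `(x, σ)`, equations `(e, σ)`, `σ : Fin (2n) × Fin 3 → 𝔽₂` one bit per incidence, `E' (e, σ) i = (E e i, σ + 1_{(e,i)})`;
  a cycle upstairs projects to a closed non-backtracking walk downstairs using every incidence an EVEN number of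
  times, hence supported on `< g` edges if shorter than `2g`, i.e. on a forest — impossible. Iterated from the
  `K_{3,6}` system (3 variables, 6 equations, every scope = all three variables; PROVED here: `base_system`,
  `exists_girthSystem`) this gives, for every `g`, a system with `m = 2n`, occurrences `≤ 6`, injective scopes and
  incidence girth `≥ g` — fact-free (in print such `(6,3)`-biregular graphs of every girth are Füredi–Lazebnik–
  Seress–Ustimenko–Woldar, JCTB 64 (1995) 228–239, doi:10.1006/jctb.1995.1033; explicit ones Margulis 1982,
  doi:10.1007/bf02579283 — neither is needed);
* `stub_boundary_of_girth` (Lemma D of the card) — incidence girth `> 2s` ⇒ every set `T` of `≤ s` equations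
  spans a FOREST, so `|∂T| ≥ 2|N(T)| − 3|T| ≥ |T| + 2`: the `(s, 1)`-boundary expansion under which
  `XorSystem.good_empty/good_extend` (PROVED) make `XorSystem.Good (scope E) b s` a consistency family with
  bound `K₀` whenever `2K₀ ≤ s` — for EVERY right-hand side `b`;
* `stub_farRhs` (Lemma E) — if `m ≥ 2n` then some `b ∈ 𝔽₂^m` is at Hamming distance `> m/20` from all `2ⁿ`
  vectors `(Σ_i h(E e i))_e` (`2ⁿ · Σ_{i ≤ m/20} C(m,i) ≤ 2^{m/2} 2^{H(1/20) m} < 2^m`, `H(1/20) = 0.2864`), i.e.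
  every assignment violates `> m/20` equations of `(E, b)` while `h = 0` satisfies `(E, 0)`;
* `stub_slyGadgets` — Sly 2010 Thm 2.1 derandomised (`=` hypothesis `h21` of the tree's
  `slyGadgetReduction_of_gadgets`, equivalent to the named fact `slyGadgetReduction`; the declared trust base of
  every Sly-based line on cruxes #2/#3, stated VERBATIM as in the sibling skeleton `parity-wired-ports` so that one
  discharge serves both cruxes; XL, not a lead target);
* `stub_apparatus` — THE CONTRACT with the companion line: given `slyGadgetReduction`, for every `Δ ≥ 3`,
  `λ > λ_c(Δ)`, occurrence budget `D` and amplification demand `r` there are constants `A, c₁ > 0, c₂` with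
  `r·c₂ < c₁` and a uniform construction `E ↦ (Γ_b)_{b ∈ 𝔽₂^m}` of graphs on ONE vertex set `Fin N`,
  `0 < N ≤ A(n+m)`, max degree `≤ Δ`, such that (Duplicator) `Γ_0 ≡_{C^k} Γ_b` whenever `Good (scope E) b s` is a
  consistency family with bound `K₀ ≥ 3k` (`s ≥ 1`), and (energy) `e^{c₁ t − c₂ n} Z(Γ_b) ≤ Z(Γ_0)` whenever every
  assignment violates `≥ t` equations of `(E, b)`. This is Lemmas A (lifting), B (copy-explicit accounting) and
  C (contrast `F₀ − F₁ = λ⁴(q⁺−q⁻)³`) of `literal-gadgets-cfi-apparatus` plus its sector inequality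
  `κ₁ log slyB ≥ KD(log R + log ρ)` and parameter choice, with `c₁ = K log ρ`, `c₂ = 2 log n₁ + 2 log((1+δ₁)/(1−δ₁))`,
  `A = max(2v, 10K)` at ONE gadget size `n₁ = n₁(Δ, λ, D, r)` (`K ≍ n₁^θ ≫ log n₁` gives `r c₂ < c₁`).
The composition `MacroscopicTwinsAbove_of` (kernel-checked, no `sorry` of its own) runs: apparatus at `D = 6`,
`r = 40` ⇒ `δ := c₁/(120(A+1))`; for each `k`: `s = 6k+6`, a girth-`≥ 2s+1` system (`exists_girthSystem`) ⇒
expansion (`stub_boundary_of_girth`) ⇒ `IsConsistencyFamily (Good (scope E) b s) (3k+3)`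
(`isConsistencyFamily_good`, `p = q = 1`, PROVED) ⇒ `Γ_0 ≡_{C^k} Γ_b` ⇒ hom-indistinguishability below treewidth
`k` (`Dvorak2010.homCount_eq_of_ckEquiv`, PROVED); far `b` (`stub_farRhs`, `t = m/20 = n/10`) ⇒
`log Z(Γ_0) − log Z(Γ_b) ≥ c₁ n/10 − c₂ n ≥ c₁ n/40 ≥ δ N` since `N ≤ 3An`.

Stubs (5): `stub_girthDoubling` (M–L; hardest provable-now stub of the source), `stub_boundary_of_girth` (M),
`stub_farRhs` (M), `stub_slyGadgets` (XL, trust base), `stub_apparatus` (XL; = the companion line, whose own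
skeleton decomposes it — this line supplies its SOURCE and fixes its CONTRACT; hardest overall).

Disproof.lean (cycle 1, verdict NOT refuted) and the landed `Theorems/MacroscopicTwinsAbove/Negative/DefectBound.lean`
(p73833; read in full — its import is left out only because the farm reported the module unbuilt at planning time,
`remote:stale:unbuilt`; add `import Summits.PneNP.PneNP.Theorems.MacroscopicTwinsAbove.Negative.DefectBound` once built):
`false_without_threshold_of_densityContinuityBelow` — `λ > λ_c`
is used at `stub_slyGadgets`/`stub_apparatus` only (`q⁺ ≠ q⁻`); `false_without_degreeFloor` — `3 ≤ Δ` enters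
`stub_slyGadgets`; `withoutPosN_trivial` — `0 < N` is a clause of `stub_apparatus` (from `0 < n` of
`exists_girthSystem`); tightness `defect_bound`/`defect_bound_perm`/`delta_le_of_blocks` — honoured: `b` has
`> m/20` ones (`h = 0` satisfies `(E,0)`), so `Γ_0`, `Γ_b` differ on `≥ K·m/20 = Θ(N)` complexes under any
alignment, and `δ = c₁/(120(A+1)) ≤ K log ρ/(1200 K) ≪ log(1+λ)` (`delta_le_log`); `lt_card_of_witness` /
`not_singlePair` — a FRESH system per `k` (girth `≥ 12k+13` forces `n ≥ 2^{Ω(k)}`), `δ` fixed first;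
`swapped_of_constantFactorTwins` — not relied on. No `-- Targets` stub kills exist (cycle 1). Negatives index
(PneNP: 0265, 0988, 10247, 2493, 2222): unrelated. No stub is an instance of a landed Negative lemma: the only
witness-shaped statement is the conclusion of `MacroscopicTwinsAbove_of` itself.
-/

noncomputable section

open scoped Classical BigOperators

namespace Summit.PneNP.PneNP.Cruxes.MacroscopicTwinsAbove.GirthTwins

open Finset
open Literature.Computability.Complexity (slyGadgetReduction slyGadgetReduction_of_gadgets SlyPropA SlyPropB
  slyM)
open Literature.Probability.LatticeModels (independencePolynomial hardCoreThreshold hardCoreThreshold_pos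
  independencePolynomial_pos)
open Literature.ModelTheory.FiniteModelTheory (CkEquiv IsConsistencyFamily)
open Literature.ModelTheory.FiniteModelTheory.XorHamGame (scope isConsistencyFamily_good)
open Literature.Combinatorics.SimpleGraph (treewidth)
open Summit.PneNP.PneNP.Theses.PhaseTwins (MacroscopicTwinsAbove)

set_option linter.unusedVariables false
set_option linter.dupNamespace false

/-! ## The stubs -/

/-- **S1 — girth doubling by the `ℤ₂`-voltage lift (the SOURCE; replaces the cited existence theorem of the
card by an elementary covering lemma).** A 3-uniform system with `m = 2n` equations, three DISTINCT variables per
equation and every variable in `≤ D` equations, whose variable–equation incidence graph (`x ∼ e` iff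
`x ∈ scope e`) has girth `≥ g` (`egirth`; `⊤` = acyclic allowed), lifts to a system of the same shape on `n' ≥ n`
variables whose incidence graph has girth `≥ 2g`. Why true: with `Λ := (Fin (2n) × Fin 3 → ZMod 2)` (one bit per
incidence) put `n' = n|Λ|`, variables `(x, σ)`, equations `(e, σ)`, `E' (e, σ) i := (E e i, σ + 1_{(e,i)})`
(reindexed by `Fin` through `Fintype.equivFin`; `|Fin (2n) × Λ| = 2(n|Λ|)`). Scopes stay injective, the
occurrences of `(x, τ)` are in bijection with those of `x` (`σ` is determined), and forgetting `σ` is a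
homomorphism of incidence graphs injective on neighbourhoods; so a cycle of length `L` upstairs projects to a
CLOSED NON-BACKTRACKING walk downstairs whose `Λ`-displacement `Σ 1_{(e_j,i_j)}` vanishes, i.e. every incidence
(= edge, by injectivity of scopes) is used an EVEN number of times: if `L < 2g` the walk lives on `< g` edges,
which span no cycle (a cycle on them would have length `< g ≤ girth`), and a forest carries no closed
non-backtracking walk (below the girth non-backtracking walks are paths:
`AlonHooryLinial.cons_isPath_of_lt_egirth`, `path_unique_of_lt_girth` in `Literature/Combinatorics/SimpleGraph/
MooreBound*.lean`; Mathlib `IsPath.exists_isCycle_length_le_add_of_ne`, `le_egirth`, `Iso.egirth_eq`). Iterated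
from the `K_{3,6}` system this yields systems of every girth (`exists_girthSystem`, PROVED below); in print:
`(r,s,t)`-graphs for all `r,s,t ≥ 2`, Füredi–Lazebnik–Seress–Ustimenko–Woldar 1995. Size M–L (the lift, the
projection of cycles, the parity count, `Fin` reindexing). -/
theorem stub_girthDoubling {n D g : ℕ} (E : Fin (2 * n) → Fin 3 → Fin n) (hE : ∀ e, Function.Injective (E e))
    (hocc : ∀ x : Fin n, (Finset.univ.filter fun p : Fin (2 * n) × Fin 3 => E p.1 p.2 = x).card ≤ D)
    (hg : ((g : ℕ) : ℕ∞) ≤ (SimpleGraph.fromRel fun x y : Fin n ⊕ Fin (2 * n) =>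
        ∃ (e : Fin (2 * n)) (i : Fin 3), x = Sum.inl (E e i) ∧ y = Sum.inr e).egirth) :
    ∃ (n' : ℕ) (E' : Fin (2 * n') → Fin 3 → Fin n'), n ≤ n' ∧
      (∀ e, Function.Injective (E' e)) ∧
      (∀ x : Fin n', (Finset.univ.filter fun p : Fin (2 * n') × Fin 3 => E' p.1 p.2 = x).card ≤ D) ∧
      ((2 * g : ℕ) : ℕ∞) ≤ (SimpleGraph.fromRel fun x y : Fin n' ⊕ Fin (2 * n') =>
        ∃ (e : Fin (2 * n')) (i : Fin 3), x = Sum.inl (E' e i) ∧ y = Sum.inr e).egirth := by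
  sorry

/-- **S2 — Lemma D: incidence girth `> 2s` gives `(s, 1)`-boundary expansion (unique neighbours from girth).**
If the scopes are injective and the incidence graph has no cycle of length `≤ 2s`, then every set `T` of at most
`s` equations has at least `|T|` (indeed `|T| + 2` when `T ≠ ∅`) boundary variables — variables lying in exactly
one scope of `T` (`XorSystem.boundary`). Why true (triage r1-1/2/3 re-derived it): the sub-incidence graph on
`T ∪ N(T)` has exactly `3|T|` edges (injective scopes) and no cycle (a cycle through `j ≤ |T| ≤ s` equation nodes
has length `2j ≤ 2s`), so it is a forest: `3|T| ≤ |T| + |N(T)| − 1`; and `3|T| = Σ_{x ∈ N(T)} deg_T x ≥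
|∂T| + 2(|N(T)| − |∂T|)` gives `|∂T| ≥ 2|N(T)| − 3|T| ≥ |T| + 2`. This is exactly the hypothesis shape
`q|T| ≤ p|∂T|` (`p = q = 1`) of the PROVED `XorSystem.good_empty/good_extend`/`isConsistencyFamily_good`.
Size M (forest edge count for a `fromRel` graph: components are trees, `IsTree.card_edgeFinset`; or induction on
`|T|` via a leaf equation). -/
theorem stub_boundary_of_girth {n m s : ℕ} (E : Fin m → Fin 3 → Fin n) (hE : ∀ e, Function.Injective (E e))
    (hg : ((2 * s + 1 : ℕ) : ℕ∞) ≤ (SimpleGraph.fromRel fun x y : Fin n ⊕ Fin m =>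
        ∃ (e : Fin m) (i : Fin 3), x = Sum.inl (E e i) ∧ y = Sum.inr e).egirth)
    (T : Finset (Fin m)) (hT : T.card ≤ s) :
    T.card ≤ (Literature.ModelTheory.FiniteModelTheory.XorSystem.boundary (scope E) T).card := by
  sorry

/-- **S3 — Lemma E: a far right-hand side by counting (no probability, no expansion).** If `m ≥ 2n` (and
`m ≥ 1`) then some `b : Fin m → 𝔽₂` makes EVERY assignment `h : Fin n → 𝔽₂` violate at least `m/20` of the
equations `Σ_i h(E e i) = b e`. Why true: the vectors `(Σ_i h(E e i))_e`, `h ∈ 𝔽₂ⁿ`, number `≤ 2ⁿ ≤ 2^{m/2}`,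
and Hamming balls of radius `⌊m/20⌋` have `Σ_{i ≤ m/20} C(m, i) ≤ 2^{H(1/20) m}` points, `H(1/20) = 0.2864 < 1/2`
(elementarily: `C(m,i) ≤ (3m/i)^i` and `(j+1)·(3·m/j)^j < 2^{m/2}` at `j = ⌊m/20⌋ ≥ 1`; for `m < 20` the radius is
`0` and `2ⁿ < 2^m`), so the balls around the `≤ 2^{m/2}` vectors do not cover `𝔽₂^m`; any uncovered `b` is at
distance `> m/20` from all of them, i.e. `20 · #violated > m`. (The tree's Hoeffding/first-moment toolkit of
`AtseriasDawar3XorProofs.lean` is an alternative.) Size M. -/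
theorem stub_farRhs {n m : ℕ} (E : Fin m → Fin 3 → Fin n) (hm : 0 < m) (hmn : 2 * n ≤ m) :
    ∃ b : Fin m → ZMod 2, ∀ h : Fin n → ZMod 2,
      m ≤ 20 * (Finset.univ.filter fun e : Fin m => (∑ i : Fin 3, h (E e i)) ≠ b e).card := by
  sorry

/-- **S4 — Sly's phase gadgets = Sly 2010 Theorem 2.1, derandomised (GŠV16 Lemma 19; GGŠVY Lemma 5 / Cor. 6 for
the degree covering).** VERBATIM the sibling skeleton's `ParityWiredPorts.stub_slyGadgets` (crux #2), i.e. the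
hypothesis `h21` of the tree's `slyGadgetReduction_of_gadgets`, hence EQUIVALENT to the named fact
`slyGadgetReduction`: for `Δ ≥ 3`, `λ > λ_c(Δ)` there are `d ∈ [3, Δ]` with `λ > λ_c(d)`, `θ ∈ (0,1/8)`,
`0 < q⁻ < q⁺ < 1` and, for all large `n`, a gadget on `≤ 3n` vertices of maximum degree `≤ d` with `2m` distinct
ports of degree `≤ d-1` (`m = slyM d θ n`) satisfying `(GpropA)` at `n` and `(GpropB)` with `δ = n^{-2θ}`. The
trust base of every Sly-based line on cruxes #2/#3 (triage r1-1/2/3 "common ceiling"; in print: Sly10 Thm 2.1,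
GGŠVY11, GŠV16 L4+L19, CGGGJŠV16 Def. 6/Lemma 9; tree programme `HardcoreInapproximabilityProofs` in progress).
Size XL (vendored-fact strength; NOT a lead-prover target; one discharge serves both cruxes). -/
theorem stub_slyGadgets : ∀ Δ : ℕ, 3 ≤ Δ → ∀ lam : ℝ, hardCoreThreshold Δ < lam →
    ∃ d : ℕ, 3 ≤ d ∧ d ≤ Δ ∧ hardCoreThreshold d < lam ∧
    ∃ θ qp qm : ℝ, 0 < θ ∧ θ < 1 / 8 ∧ 0 < qm ∧ qm < qp ∧ qp < 1 ∧
      ∃ n₁ : ℕ, ∀ n : ℕ, n₁ ≤ n →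
        ∃ (v : ℕ) (G : SimpleGraph (Fin v)) (Wp Wm : Finset (Fin v))
          (Vp Vm : Fin (slyM d θ n) ↪ Fin v),
          (v : ℝ) ≤ 3 * n ∧ G.maxDegree ≤ d ∧ Disjoint Wp Wm ∧
            Disjoint (Set.range Vp) (Set.range Vm) ∧
            (∀ i, G.degree (Vp i) ≤ d - 1) ∧ (∀ i, G.degree (Vm i) ≤ d - 1) ∧
            SlyPropA G lam Wp Wm n ∧
            SlyPropB G lam Wp Wm Vp Vm qp qm ((n : ℝ) ^ (-(2 * θ))) := by
  sorry

/-- **S5 — THE APPARATUS CONTRACT (literal gadgets + CFI parity complexes at ONE fixed gadget size; the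
companion line `literal-gadgets-cfi-apparatus ≈ hypergraph-tseitin-fixed-gadget`).** Given Sly's gadget fact,
for every `Δ ≥ 3`, `λ > λ_c(Δ)`, occurrence budget `D` and amplification demand `r` there are a size constant
`A`, a gain `c₁ > 0` per unavoidably violated equation and a cost `c₂` per variable with `r · c₂ < c₁`, and for
every 3-uniform system `E` on `n ≥ 1` variables with injective scopes and occurrences `≤ D` a family of graphs
`Γ_b` (`b ∈ 𝔽₂^m`) on ONE vertex set `Fin N`, `0 < N ≤ A(n+m)`, all of maximum degree `≤ Δ`, such that
(Duplicator) `Γ_0 ≡_{C^k} Γ_b` whenever the radius-`s` consistent partial assignments of `(E, b)` form a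
consistency family with bound `K₀ ≥ 3k` (`s ≥ 1`), and (energy) `e^{c₁ t − c₂ n} · Z_{Γ_b}(λ) ≤ Z_{Γ_0}(λ)`
whenever every assignment violates `≥ t` equations of `(E, b)`. Why true (the companion card, verified end to
end in the idealised model by triage r1-2 F2–F5 and by hand by r1-1/r1-3): fix `d, θ, q±` and ONE gadget size
`n₁` from the fact, `P = slyM d θ n₁` ports per side; `Γ_b` = two gadget copies `g_{x,0}, g_{x,1}` per variable
anti-aligned by `κ₁` two-sided port pairs (`V⁺–V⁺` AND `V⁻–V⁻`), and `K` ten-vertex CFI complexes of charge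
`b e` per equation, the end `(i, a)` of complex `(e, j)` plugged into a `V⁺` port of `g_{E e i, a}` addressed by
(occurrence index, `j`) — `DK + κ₁ ≤ P`; inner vertices indexed `b`-independently so all `Γ_b` live on one
type. Degrees: ports `(d-1)+1`, ends `2+1`, inners `3`. DUPLICATOR = `ckEquiv_of_consistencyFamily` (PROVED) with
the block-swap flip `(x,a,y) ↦ (x,a+f x,y)`, `(e,j,(i,a)) ↦ (e,j,(i,a+f(E e i)))`, `S' ↦ S' + f|_e`, data `{x}`
resp. `scope e` (`c₀ = 3`), compat = `Good.sum_scope_eq` (needs `1 ≤ s`). ENERGY: `(GpropB)` sandwiches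
`Z_{Γ_b}(Y) ∈ (1±δ₁)^{2n} · W_b(Y) · Z_base(Y)` for every phase vector `Y` (Lemma B), `Z_base(Y₀) ≥ n₁^{-2n} Z_base`
(`(GpropA)`), `Σ_Y Z_base(Y) = Z_base` (no entropy term), and `max_Y W_b(Y) ≤ ρ^{-Kt} W_0(Y₀)` once
`κ₁ log slyB ≥ KD(log R + log ρ)` (aligned variables never pay), `ρ = F₀/F₁ > 1` by the contrast identity
`F₀ − F₁ = λ⁴(q⁺−q⁻)³` (Lemma C; kit j007440/j009414/j009588); so `c₁ = K log ρ`,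
`c₂ = 2 log n₁ + 2 log((1+δ₁)/(1−δ₁))`, `A = max(2v, 10K)`, and `K ≍ n₁^θ log slyB/(2D(log R + log ρ + log slyB))
≫ r(2 log n₁ + 1)` for `n₁` large gives `r c₂ < c₁`. The threshold enters exactly here (`q⁺ ≠ q⁻`). Size XL — it
is the companion line; its skeleton's stubs (wiring/transfer, connector sandwich, contrast, sector inequality,
parameters) prove this statement, and the lead may reshape this stub into them. -/
theorem stub_apparatus (hsly : slyGadgetReduction) :
    ∀ Δ : ℕ, 3 ≤ Δ → ∀ lam : ℝ, hardCoreThreshold Δ < lam → ∀ (D : ℕ) (r : ℝ),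
      ∃ (A : ℕ) (c₁ c₂ : ℝ), 0 < c₁ ∧ r * c₂ < c₁ ∧
        ∀ (n m : ℕ) (E : Fin m → Fin 3 → Fin n), 0 < n → (∀ e, Function.Injective (E e)) →
          (∀ x : Fin n, (Finset.univ.filter fun p : Fin m × Fin 3 => E p.1 p.2 = x).card ≤ D) →
          ∃ (N : ℕ) (Γ : (Fin m → ZMod 2) → SimpleGraph (Fin N)),
            0 < N ∧ N ≤ A * (n + m) ∧ (∀ b, (Γ b).maxDegree ≤ Δ) ∧
            (∀ (b : Fin m → ZMod 2) (s K₀ k : ℕ), 1 ≤ s →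
                IsConsistencyFamily
                  (Literature.ModelTheory.FiniteModelTheory.XorSystem.Good (scope E) b s) K₀ →
                3 * k ≤ K₀ → CkEquiv k (Γ 0) (Γ b)) ∧
            (∀ (b : Fin m → ZMod 2) (t : ℝ),
                (∀ h : Fin n → ZMod 2,
                  t ≤ ((Finset.univ.filter fun e : Fin m => (∑ i : Fin 3, h (E e i)) ≠ b e).card : ℝ)) →
                Real.exp (c₁ * t - c₂ * n) * independencePolynomial (Γ b) lam ≤
                  independencePolynomial (Γ 0) lam) := by
  sorry

/-! ## Proved glue -/

/-! ### The source: systems of every incidence girth from `stub_girthDoubling` -/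

/-- The base system: `K_{3,6}` read as a system — `3` variables, `6 = 2·3` equations, every scope = all three
variables: injective scopes, occurrences `6`, incidence girth `≥ 3` (indeed `4`). -/
theorem base_system : ∃ (n : ℕ) (E : Fin (2 * n) → Fin 3 → Fin n), 0 < n ∧
    (∀ e, Function.Injective (E e)) ∧
    (∀ x : Fin n, (Finset.univ.filter fun p : Fin (2 * n) × Fin 3 => E p.1 p.2 = x).card ≤ 6) ∧
    ((3 : ℕ) : ℕ∞) ≤ (SimpleGraph.fromRel fun x y : Fin n ⊕ Fin (2 * n) =>
      ∃ (e : Fin (2 * n)) (i : Fin 3), x = Sum.inl (E e i) ∧ y = Sum.inr e).egirth := by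
  refine ⟨3, fun _ i => i, by norm_num, fun _ => Function.injective_id, fun x => ?_, ?_⟩
  · -- the six occurrences of `x` are the pairs `(e, x)`
    have h : (Finset.univ.filter fun p : Fin (2 * 3) × Fin 3 => p.2 = x) =
        (Finset.univ : Finset (Fin (2 * 3))).image fun e => (e, x) := by
      ext p
      simp only [Finset.mem_filter, Finset.mem_univ, true_and, Finset.mem_image]
      constructor
      · intro hp
        exact ⟨p.1, Prod.ext rfl hp.symm⟩
      · rintro ⟨e, rfl⟩
        rfl
    rw [h]
    exact Finset.card_image_le.trans (by simp)
  · exact_mod_cast SimpleGraph.three_le_egirth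

/-- Iterating the lift: systems of incidence girth `≥ 3 · 2^t` for every `t`. -/
theorem girthSystem_iter (t : ℕ) : ∃ (n : ℕ) (E : Fin (2 * n) → Fin 3 → Fin n), 0 < n ∧
    (∀ e, Function.Injective (E e)) ∧
    (∀ x : Fin n, (Finset.univ.filter fun p : Fin (2 * n) × Fin 3 => E p.1 p.2 = x).card ≤ 6) ∧
    ((3 * 2 ^ t : ℕ) : ℕ∞) ≤ (SimpleGraph.fromRel fun x y : Fin n ⊕ Fin (2 * n) =>
      ∃ (e : Fin (2 * n)) (i : Fin 3), x = Sum.inl (E e i) ∧ y = Sum.inr e).egirth := by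
  induction t with
  | zero => simpa using base_system
  | succ t ih =>
    obtain ⟨n, E, hn, hinj, hocc, hg⟩ := ih
    obtain ⟨n', E', hnn', hinj', hocc', hg'⟩ := stub_girthDoubling E hinj hocc hg
    refine ⟨n', E', hn.trans_le hnn', hinj', hocc', ?_⟩
    have h2 : 3 * 2 ^ (t + 1) = 2 * (3 * 2 ^ t) := by ring
    rw [h2]
    exact hg'

/-- **Systems of every incidence girth** (what the card cited from Füredi–Lazebnik–Seress–Ustimenko–Woldar 1995,
here DERIVED from `stub_girthDoubling`): for every `g` a 3-uniform system with `m = 2n` equations on `n ≥ 1`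
variables, injective scopes, occurrences `≤ 6`, incidence girth `≥ g`. -/
theorem exists_girthSystem (g : ℕ) : ∃ (n : ℕ) (E : Fin (2 * n) → Fin 3 → Fin n), 0 < n ∧
    (∀ e, Function.Injective (E e)) ∧
    (∀ x : Fin n, (Finset.univ.filter fun p : Fin (2 * n) × Fin 3 => E p.1 p.2 = x).card ≤ 6) ∧
    ((g : ℕ) : ℕ∞) ≤ (SimpleGraph.fromRel fun x y : Fin n ⊕ Fin (2 * n) =>
      ∃ (e : Fin (2 * n)) (i : Fin 3), x = Sum.inl (E e i) ∧ y = Sum.inr e).egirth := by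
  obtain ⟨n, E, hn, hinj, hocc, hg⟩ := girthSystem_iter g
  refine ⟨n, E, hn, hinj, hocc, le_trans ?_ hg⟩
  have : g ≤ 3 * 2 ^ g := (Nat.lt_two_pow_self).le.trans (Nat.le_mul_of_pos_left _ (by norm_num))
  exact_mod_cast this

/-! ### Small conversions -/

/-- The route's inlined sum IS `independencePolynomial`, for ANY decidability instances. -/
theorem indepSum_eq {α : Type*} [Fintype α] [DecidableEq α] (G : SimpleGraph α) {iG : DecidableRel G.Adj}
    {dI : ∀ I : Finset α, Decidable (G.IsIndepSet (↑I : Set α))} (lam : ℝ) :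
    (∑ I : Finset α, @ite ℝ (G.IsIndepSet (↑I : Set α)) (dI I) (lam ^ I.card) 0) =
      @independencePolynomial α _ _ G iG ℝ _ lam := by
  unfold independencePolynomial
  exact Finset.sum_congr rfl fun I _ => by congr

/-- Transport of a degree bound across decidability instances (the crux statement carries the classical ones). -/
theorem maxDegree_le_of_le {α : Type*} [Fintype α] {G : SimpleGraph α} {i₁ i₂ : DecidableRel G.Adj} {Δ : ℕ}
    (h : @SimpleGraph.maxDegree α G _ i₁ ≤ Δ) : @SimpleGraph.maxDegree α G _ i₂ ≤ Δ := by
  have : i₁ = i₂ := Subsingleton.elim _ _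
  subst this
  exact h

/-! ## The composition (kernel-checked, no `sorry` of its own) -/

/-- **`MacroscopicTwinsAbove` from the five stubs.** Given `Δ ≥ 3` and `λ > λ_c(Δ)`: S4 + the PROVED
`slyGadgetReduction_of_gadgets` give the gadget fact; S5 at `D = 6`, `r = 40` gives `A, c₁, c₂` and the
construction; `δ := c₁ / (120 (A + 1))`. For each `k`, with `s = 6k + 6`: `exists_girthSystem` (S1 iterated from
`K_{3,6}`) gives a system of girth `≥ 2s + 1`
on `n ≥ 1` variables, `m = 2n`; S2 gives `(s,1)`-expansion, so `Good (scope E) b s` is a consistency family with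
bound `3k + 3` (`isConsistencyFamily_good`, PROVED) and S5 yields `Γ_0 ≡_{C^k} Γ_b`, converted into the typed
hom-count clause by `Dvorak2010.homCount_eq_of_ckEquiv` (PROVED); S3 gives a far `b` (`t = m/20 = n/10`), and
S5's energy clause gives `e^{c₁ n/10 − c₂ n} Z(Γ_b) ≤ Z(Γ_0)` with `c₁ n/10 − c₂ n ≥ c₁ n/40 ≥ δ N`
(`N ≤ 3An`, `40 c₂ < c₁`). -/
theorem MacroscopicTwinsAbove_of : MacroscopicTwinsAbove := by
  intro Δ hΔ lam hlam
  have hlam' : hardCoreThreshold Δ < lam := hlam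
  have hlam0 : 0 < lam := (hardCoreThreshold_pos hΔ).trans hlam'
  have hsly : slyGadgetReduction := slyGadgetReduction_of_gadgets stub_slyGadgets
  obtain ⟨A, c₁, c₂, hc₁, hrc, happ⟩ := stub_apparatus hsly Δ hΔ lam hlam' 6 40
  have hA1 : (0 : ℝ) < (A : ℝ) + 1 := by positivity
  refine ⟨c₁ / (120 * ((A : ℝ) + 1)), by positivity, fun k => ?_⟩
  -- the system for this `k`
  obtain ⟨n, E, hn, hinj, hocc, hgirth⟩ := exists_girthSystem (2 * (6 * k + 6) + 1)
  have hexp : ∀ T : Finset (Fin (2 * n)), T.card ≤ 6 * k + 6 →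
      1 * T.card ≤ 1 * (Literature.ModelTheory.FiniteModelTheory.XorSystem.boundary (scope E) T).card :=
    fun T hT => by
      rw [one_mul, one_mul]
      exact stub_boundary_of_girth (s := 6 * k + 6) E hinj hgirth T hT
  obtain ⟨b, hb⟩ := stub_farRhs E (by omega) le_rfl
  obtain ⟨N, Γ, hN, hNA, hdeg, hdup, hgap⟩ := happ n (2 * n) E hn hinj hocc
  refine ⟨N, Γ 0, Γ b, hN, maxDegree_le_of_le (hdeg 0), maxDegree_le_of_le (hdeg b), ?_, ?_⟩
  · -- homomorphism indistinguishability below treewidth `k`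
    intro mF F hF
    rcases Nat.eq_zero_or_pos k with hk0 | hk1
    · subst hk0
      exact absurd hF (Nat.not_lt_zero _)
    have hfam : IsConsistencyFamily
        (Literature.ModelTheory.FiniteModelTheory.XorSystem.Good (scope E) b (6 * k + 6)) (3 * k + 3) :=
      isConsistencyFamily_good (p := 1) (q := 1) one_pos hexp (by omega)
    have hck : CkEquiv k (Γ 0) (Γ b) := hdup b (6 * k + 6) (3 * k + 3) k (by omega) hfam (by omega)
    exact Literature.ModelTheory.FiniteModelTheory.Dvorak2010.homCount_eq_of_ckEquiv hk1 hck F hF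
  · -- the macroscopic gap
    have ht : ∀ h : Fin n → ZMod 2, ((2 * n : ℕ) : ℝ) / 20 ≤
        ((Finset.univ.filter fun e : Fin (2 * n) => (∑ i : Fin 3, h (E e i)) ≠ b e).card : ℝ) := by
      intro h
      have h1 : ((2 * n : ℕ) : ℝ) ≤
          20 * ((Finset.univ.filter fun e : Fin (2 * n) => (∑ i : Fin 3, h (E e i)) ≠ b e).card : ℝ) := by
        exact_mod_cast hb h
      linarith
    have hmain := hgap b (((2 * n : ℕ) : ℝ) / 20) ht
    have hZb : 0 ≤ independencePolynomial (Γ b) lam := (independencePolynomial_pos _ hlam0.le).le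
    -- the exponent comparison `δ N ≤ c₁ n/10 − c₂ n`
    have hnR : (0 : ℝ) ≤ n := Nat.cast_nonneg n
    have hNR : (N : ℝ) ≤ A * (n + 2 * n) := by exact_mod_cast hNA
    have hc₂ : c₂ * n ≤ c₁ / 40 * n := by
      refine mul_le_mul_of_nonneg_right ?_ hnR
      linarith
    have hδN : c₁ / (120 * ((A : ℝ) + 1)) * N ≤ c₁ * (((2 * n : ℕ) : ℝ) / 20) - c₂ * n := by
      have hAfrac : (A : ℝ) / ((A : ℝ) + 1) ≤ 1 := by
        rw [div_le_one hA1]; linarith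
      have h2n : (((2 * n : ℕ) : ℝ) / 20) = (n : ℝ) / 10 := by push_cast; ring
      rw [h2n]
      calc c₁ / (120 * ((A : ℝ) + 1)) * N ≤ c₁ / (120 * ((A : ℝ) + 1)) * (A * (n + 2 * n)) :=
            mul_le_mul_of_nonneg_left hNR (by positivity)
        _ = c₁ * n / 40 * ((A : ℝ) / ((A : ℝ) + 1)) := by
            field_simp
            ring
        _ ≤ c₁ * n / 40 * 1 := mul_le_mul_of_nonneg_left hAfrac (by positivity)
        _ ≤ c₁ * ((n : ℝ) / 10) - c₂ * n := by nlinarith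
    have hexp_le : Real.exp (c₁ / (120 * ((A : ℝ) + 1)) * N) ≤
        Real.exp (c₁ * (((2 * n : ℕ) : ℝ) / 20) - c₂ * n) := Real.exp_le_exp.2 hδN
    have hfin : Real.exp (c₁ / (120 * ((A : ℝ) + 1)) * N) * independencePolynomial (Γ b) lam ≤
        independencePolynomial (Γ 0) lam :=
      (mul_le_mul_of_nonneg_right hexp_le hZb).trans hmain
    rw [← indepSum_eq (Γ b) lam, ← indepSum_eq (Γ 0) lam] at hfin
    convert hfin using 2

end Summit.PneNP.PneNP.Cruxes.MacroscopicTwinsAbove.GirthTwins
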